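import Summits.CriticalPhenomena.CardyFormulaZ2.Theorems.CardyIKTransportIKMixedBoxCrossingTransportDefs

/-!
# Stub `stub_cylBunch` (line `defect-closure-exploration`, reshape v4, crux `IKMixedBoxCrossing`,
# stmt-CriticalPhenomena-5911)

Support file (`--supports stmt-CriticalPhenomena-5911`): `CylExchange → SlabDeterminacy → CylBunching`.

Three ingredients.
* (A) INVARIANCE UNDER PERMUTATIONS OF THE FACE TYPES (`cylArcs_comp_perm`): swapping two adjacent face types
  of different kind preserves `cylArcs` (`CylExchange` fed with `SlabDeterminacy`), of equal kind is the identity;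
  adjacent transpositions generate the symmetric group (`Equiv.Perm.mclosure_swap_castSucc_succ`).  Sorting the
  types (`Tuple.sort`, possibly followed by `Fin.revPerm`) makes them constant on the first `w / 2` face columns
  (`exists_sorted`).
* (B) RESTRICTION TO A LEFT SUB-SLAB (`cylProb_resLE`): the slab law pushed forward to the sub-slab of the first
  `w'` face columns is the sub-slab law — summing out the last cell column together with the last face column
  multiplies numerator and partition function by the same positive constant `colConst` (reindex the colours of
  the last column by their xor with the previous column, `colSum_eq_colConst`); induct on the width.
* (C) MONOTONICITY (`resLE_preimage_arcsEvent_subset`, `cylProb_mono`): a black path inside the sub-slab is a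
  black path inside the slab (graph homomorphism induced by `Fin.castLE` on the columns), and `cylProb` is
  monotone in the event (nonnegative weights).
-/

noncomputable section

namespace Summit.CriticalPhenomena.CardyFormulaZ2.Cruxes.IKMixedBoxCrossing.DefectClosureExploration

open scoped BigOperators Classical
open Finset
open Summit.CriticalPhenomena.CardyFormulaZ2.Theorems.IKLinearTransport.PinnedDiagramExchange (faceWeight)

namespace CylBunchStub

/-! ## §1 Nonnegativity and monotonicity of `cylProb` -/

/-- The local face weights are nonnegative. -/
theorem faceWeight_nonneg (b o a : Bool) : 0 ≤ faceWeight b o a := by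
  unfold faceWeight
  split_ifs <;> positivity

/-- The slab weights are nonnegative. -/
theorem cylWeight_nonneg (w L : ℕ) [NeZero L] (τ : Fin w → Bool) (x : CylCfg w L) :
    0 ≤ cylWeight w L τ x :=
  Finset.prod_nonneg fun _ _ => faceWeight_nonneg _ _ _

/-- The partition function is nonnegative. -/
theorem cylZ_nonneg (w L : ℕ) [NeZero L] (τ : Fin w → Bool) : 0 ≤ cylZ w L τ :=
  Finset.sum_nonneg fun x _ => cylWeight_nonneg w L τ x

/-- `cylProb` is monotone in the event. -/
theorem cylProb_mono (w L : ℕ) [NeZero L] (τ : Fin w → Bool) {E F : Set (CylCfg w L)} (h : E ⊆ F) :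
    cylProb w L τ E ≤ cylProb w L τ F := by
  unfold cylProb
  refine div_le_div_of_nonneg_right (Finset.sum_le_sum fun x _ => ?_) (cylZ_nonneg w L τ)
  by_cases hx : x ∈ E
  · rw [if_pos hx, if_pos (h hx)]
  · rw [if_neg hx]
    split_ifs
    · exact cylWeight_nonneg w L τ x
    · exact le_rfl

/-! ## §2 Restriction to a left sub-slab and black paths -/

/-- Restriction of a slab configuration to the left sub-slab of its first `w'` face columns (`w' ≤ w`): keep the
cell columns `0 … w'` and the face columns `0 … w' - 1`. -/
def resLE {w w' L : ℕ} (h : w' ≤ w) (x : CylCfg w L) : CylCfg w' L :=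
  (fun c => x.1 (Fin.castLE (Nat.succ_le_succ h) c.1, c.2), fun f => x.2 (Fin.castLE h f.1, f.2))

/-- The generating relation of `cylGraph` is preserved by the column embedding `Fin.castLE`. -/
theorem rel_castLE {w w' L : ℕ} (h : w' ≤ w) (flg : Fin w × ZMod L → Bool) (a b : Fin (w' + 1) × ZMod L)
    (hr : (b.1 = a.1 ∧ b.2 = a.2 + 1) ∨ (b.1.val = a.1.val + 1 ∧ b.2 = a.2) ∨
      (∃ j : Fin w', a.1 = j.castSucc ∧ b.1 = j.succ ∧ b.2 = a.2 + 1 ∧ flg (Fin.castLE h j, a.2) = false) ∨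
      (∃ j : Fin w', a.1 = j.castSucc ∧ b.1 = j.succ ∧ a.2 = b.2 + 1 ∧ flg (Fin.castLE h j, b.2) = true)) :
    ((Fin.castLE (Nat.succ_le_succ h) b.1 = Fin.castLE (Nat.succ_le_succ h) a.1 ∧ b.2 = a.2 + 1) ∨
      ((Fin.castLE (Nat.succ_le_succ h) b.1).val = (Fin.castLE (Nat.succ_le_succ h) a.1).val + 1 ∧
        b.2 = a.2) ∨
      (∃ j : Fin w, Fin.castLE (Nat.succ_le_succ h) a.1 = j.castSucc ∧
        Fin.castLE (Nat.succ_le_succ h) b.1 = j.succ ∧ b.2 = a.2 + 1 ∧ flg (j, a.2) = false) ∨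
      (∃ j : Fin w, Fin.castLE (Nat.succ_le_succ h) a.1 = j.castSucc ∧
        Fin.castLE (Nat.succ_le_succ h) b.1 = j.succ ∧ a.2 = b.2 + 1 ∧ flg (j, b.2) = true)) := by
  rcases hr with ⟨h1, h2⟩ | ⟨h1, h2⟩ | ⟨j, h1, h2, h3, h4⟩ | ⟨j, h1, h2, h3, h4⟩
  · exact Or.inl ⟨by rw [h1], h2⟩
  · exact Or.inr (Or.inl ⟨by simpa using h1, h2⟩)
  · refine Or.inr (Or.inr (Or.inl ⟨Fin.castLE h j, ?_, ?_, h3, h4⟩))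
    · rw [h1]; ext; simp
    · rw [h2]; ext; simp
  · refine Or.inr (Or.inr (Or.inr ⟨Fin.castLE h j, ?_, ?_, h3, h4⟩))
    · rw [h1]; ext; simp
    · rw [h2]; ext; simp

/-- The column embedding is a graph homomorphism from the triangulation of the sub-slab (restricted flags)
to the triangulation of the slab. -/
theorem cylGraph_adj_castLE {w w' L : ℕ} (h : w' ≤ w) (flg : Fin w × ZMod L → Bool)
    {a b : Fin (w' + 1) × ZMod L} (hab : (cylGraph w' L (fun f => flg (Fin.castLE h f.1, f.2))).Adj a b) :
    (cylGraph w L flg).Adj (Fin.castLE (Nat.succ_le_succ h) a.1, a.2)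
      (Fin.castLE (Nat.succ_le_succ h) b.1, b.2) := by
  rw [cylGraph, SimpleGraph.fromRel_adj] at hab ⊢
  obtain ⟨hne, hr⟩ := hab
  refine ⟨fun heq => hne ?_, hr.imp (rel_castLE h flg a b) (rel_castLE h flg b a)⟩
  simp only [Prod.mk.injEq, Fin.castLE_inj] at heq
  exact Prod.ext heq.1 heq.2

/-- A black path inside the sub-slab is a black path inside the slab. -/
theorem blackConn_resLE {w w' L : ℕ} (h : w' ≤ w) (x : CylCfg w L) (u v : Fin (w' + 1) × ZMod L)
    (huv : BlackConn (resLE h x) u v) :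
    BlackConn x (Fin.castLE (Nat.succ_le_succ h) u.1, u.2) (Fin.castLE (Nat.succ_le_succ h) v.1, v.2) := by
  obtain ⟨hu, hv, hreach⟩ := huv
  let φ : ((cylGraph w' L (resLE h x).2).induce {z | (resLE h x).1 z = true}) →g
      ((cylGraph w L x.2).induce {z | x.1 z = true}) :=
    { toFun := fun z => ⟨(Fin.castLE (Nat.succ_le_succ h) z.1.1, z.1.2), z.2⟩
      map_rel' := fun hab => cylGraph_adj_castLE h x.2 hab }
  exact ⟨hu, hv, hreach.map φ⟩

/-- (C) The arcs event of the sub-slab, pulled back to the slab, is contained in the arcs event of the slab. -/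
theorem resLE_preimage_arcsEvent_subset {w w' : ℕ} (L n : ℕ) (h : w' ≤ w) :
    (resLE h : CylCfg w L → CylCfg w' L) ⁻¹' arcsEvent w' L n ⊆ arcsEvent w L n := by
  rintro x ⟨r₁, r₂, h1, h2, h3, h4, hconn⟩
  refine ⟨r₁, r₂, h1, h2, h3, h4, ?_⟩
  simpa using blackConn_resLE h x _ _ hconn

/-! ## §3 Summing out the last cell column and the last face column -/

/-- Dropping the last cell column and the last face column. -/
def resLast {w L : ℕ} (x : CylCfg (w + 1) L) : CylCfg w L :=
  (fun c => x.1 (c.1.castSucc, c.2), fun f => x.2 (f.1.castSucc, f.2))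

/-- The COLUMN CONSTANT: the total weight of one face column of type `b` together with the cell column to its
right, the colours of the cell column to its left being `0` (it does not depend on them, `colSum_eq_colConst`). -/
def colConst (b : Bool) (L : ℕ) [NeZero L] : ℝ :=
  ∑ δ : ZMod L → Bool, ∑ φ : ZMod L → Bool, ∏ r : ZMod L, faceWeight b (δ r ^^ δ (r + 1)) (φ r)

/-- The column constant is positive (the all-white column with all flags `true` has positive weight). -/
theorem colConst_pos (b : Bool) (L : ℕ) [NeZero L] : 0 < colConst b L := by
  have h0 : (0 : ℝ) < ∏ r : ZMod L, faceWeight b ((fun _ : ZMod L => false) r ^^ (fun _ : ZMod L => false) (r + 1))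
      ((fun _ : ZMod L => true) r) :=
    Finset.prod_pos fun r _ => by unfold faceWeight; cases b <;> norm_num
  have h1 : (∏ r : ZMod L, faceWeight b ((fun _ : ZMod L => false) r ^^ (fun _ : ZMod L => false) (r + 1))
      ((fun _ : ZMod L => true) r)) ≤ ∑ φ : ZMod L → Bool, ∏ r : ZMod L,
        faceWeight b ((fun _ : ZMod L => false) r ^^ (fun _ : ZMod L => false) (r + 1)) (φ r) :=
    Finset.single_le_sum (f := fun φ : ZMod L → Bool => ∏ r : ZMod L,
        faceWeight b ((fun _ : ZMod L => false) r ^^ (fun _ : ZMod L => false) (r + 1)) (φ r))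
      (fun φ _ => Finset.prod_nonneg fun r _ => faceWeight_nonneg _ _ _) (Finset.mem_univ _)
  have h2 : (∑ φ : ZMod L → Bool, ∏ r : ZMod L,
        faceWeight b ((fun _ : ZMod L => false) r ^^ (fun _ : ZMod L => false) (r + 1)) (φ r)) ≤
      colConst b L :=
    Finset.single_le_sum (f := fun δ : ZMod L → Bool => ∑ φ : ZMod L → Bool, ∏ r : ZMod L,
        faceWeight b (δ r ^^ δ (r + 1)) (φ r))
      (fun δ _ => Finset.sum_nonneg fun φ _ => Finset.prod_nonneg fun r _ => faceWeight_nonneg _ _ _)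
      (Finset.mem_univ _)
  linarith

/-- The weight of one face column and the cell column to its right, summed over the colours `η` of that cell
column and the flags, does not depend on the colours `ξ` of the cell column to its left (reindex `η ↦ ξ ⊕ η`). -/
theorem colSum_eq_colConst (b : Bool) (L : ℕ) [NeZero L] (ξ : ZMod L → Bool) :
    ∑ η : ZMod L → Bool, ∑ φ : ZMod L → Bool,
      ∏ r : ZMod L, faceWeight b ((ξ r ^^ η r) ^^ (ξ (r + 1) ^^ η (r + 1))) (φ r) = colConst b L := by
  have hinv : Function.Involutive (fun η : ZMod L → Bool => fun r => ξ r ^^ η r) := fun η =>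
    funext fun r => by cases ξ r <;> simp
  exact Fintype.sum_equiv (hinv.toPerm _) _ _ fun η => rfl

/-- The slab weight at width `w + 1` factorises as the weight of the restriction times the weight of the last
face column. -/
theorem cylWeight_succ {w L : ℕ} [NeZero L] (τ : Fin (w + 1) → Bool) (x : CylCfg (w + 1) L) :
    cylWeight (w + 1) L τ x = cylWeight w L (fun j => τ j.castSucc) (resLast x) *
      ∏ r : ZMod L, faceWeight (τ (Fin.last w))
        ((x.1 ((Fin.last w).castSucc, r) ^^ x.1 (Fin.last (w + 1), r)) ^^
          (x.1 ((Fin.last w).castSucc, r + 1) ^^ x.1 (Fin.last (w + 1), r + 1))) (x.2 (Fin.last w, r)) := by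
  unfold cylWeight
  rw [Fintype.prod_prod_type, Fin.prod_univ_castSucc, Fintype.prod_prod_type]
  rfl

/-- Splitting a configuration of `w + 1` face columns into its restriction and its last cell and face columns. -/
def splitEquiv (w L : ℕ) : CylCfg (w + 1) L ≃ CylCfg w L × ((ZMod L → Bool) × (ZMod L → Bool)) where
  toFun x := (resLast x, fun r => x.1 (Fin.last (w + 1), r), fun r => x.2 (Fin.last w, r))
  invFun p := (fun c => Fin.lastCases (motive := fun _ => Bool) (p.2.1 c.2) (fun i => p.1.1 (i, c.2)) c.1,
    fun f => Fin.lastCases (motive := fun _ => Bool) (p.2.2 f.2) (fun j => p.1.2 (j, f.2)) f.1)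
  left_inv x := by
    refine Prod.ext (funext fun c => ?_) (funext fun f => ?_)
    · obtain ⟨c1, c2⟩ := c
      induction c1 using Fin.lastCases with
      | last => simp
      | cast i => simp [resLast]
    · obtain ⟨f1, f2⟩ := f
      induction f1 using Fin.lastCases with
      | last => simp
      | cast j => simp [resLast]
  right_inv p := by
    obtain ⟨y, η, φ⟩ := p
    simp [resLast]

/-- (B, one step) Summing out the last cell column and the last face column multiplies a restricted weighted sum
by the column constant of the last face type. -/
theorem sum_resLast {w L : ℕ} [NeZero L] (τ : Fin (w + 1) → Bool) (g : CylCfg w L → ℝ) :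
    ∑ x : CylCfg (w + 1) L, g (resLast x) * cylWeight (w + 1) L τ x =
      (∑ y : CylCfg w L, g y * cylWeight w L (fun j => τ j.castSucc) y) * colConst (τ (Fin.last w)) L := by
  rw [Fintype.sum_equiv (splitEquiv w L) _ (fun p : CylCfg w L × ((ZMod L → Bool) × (ZMod L → Bool)) =>
      g p.1 * (cylWeight w L (fun j => τ j.castSucc) p.1 * ∏ r : ZMod L, faceWeight (τ (Fin.last w))
        ((p.1.1 (Fin.last w, r) ^^ p.2.1 r) ^^ (p.1.1 (Fin.last w, r + 1) ^^ p.2.1 (r + 1))) (p.2.2 r)))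
      (fun x => by rw [cylWeight_succ]; rfl)]
  rw [Fintype.sum_prod_type, Finset.sum_mul]
  refine Finset.sum_congr rfl fun y _ => ?_
  rw [Fintype.sum_prod_type, ← colSum_eq_colConst (τ (Fin.last w)) L (fun r => y.1 (Fin.last w, r)),
    Finset.mul_sum]
  refine Finset.sum_congr rfl fun η _ => ?_
  rw [Finset.mul_sum]
  refine Finset.sum_congr rfl fun φ _ => ?_
  ring

/-- (B, one step) The slab law restricted to the sub-slab without the last face column is the sub-slab law. -/
theorem cylProb_resLast {w L : ℕ} [NeZero L] (τ : Fin (w + 1) → Bool) (E : Set (CylCfg w L)) :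
    cylProb (w + 1) L τ (resLast ⁻¹' E) = cylProb w L (fun j => τ j.castSucc) E := by
  have hN : (∑ x : CylCfg (w + 1) L, if x ∈ (resLast ⁻¹' E : Set (CylCfg (w + 1) L))
      then cylWeight (w + 1) L τ x else 0) =
      (∑ y : CylCfg w L, if y ∈ E then cylWeight w L (fun j => τ j.castSucc) y else 0) *
        colConst (τ (Fin.last w)) L := by
    simpa only [boole_mul, Set.mem_preimage] using sum_resLast τ (fun y => if y ∈ E then (1 : ℝ) else 0)
  have hZ : cylZ (w + 1) L τ = cylZ w L (fun j => τ j.castSucc) * colConst (τ (Fin.last w)) L := by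
    unfold cylZ
    simpa only [one_mul] using sum_resLast τ (fun _ => (1 : ℝ))
  unfold cylProb
  rw [hN, hZ, mul_div_mul_right _ _ (colConst_pos _ L).ne']

/-! ## §4 Restriction to an arbitrary left sub-slab (induction on the width) -/

/-- Restricting to `w'` face columns from `w + 1` is restricting from `w` after dropping the last column. -/
theorem resLE_succ {w w' L : ℕ} (h : w' ≤ w) (h' : w' ≤ w + 1) :
    (resLE h' : CylCfg (w + 1) L → CylCfg w' L) = resLE h ∘ resLast := rfl

/-- (B) THE MARGINAL IDENTITY: the slab law restricted to a left sub-slab is the sub-slab law. -/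
theorem cylProb_resLE {w' : ℕ} (L : ℕ) [NeZero L] (E : Set (CylCfg w' L)) :
    ∀ (w : ℕ) (h : w' ≤ w) (τ : Fin w → Bool),
      cylProb w L τ (resLE h ⁻¹' E) = cylProb w' L (fun j => τ (Fin.castLE h j)) E := by
  refine Nat.le_induction (fun τ => ?_) (fun w h ih τ => ?_)
  · have hid : (resLE (le_refl w') : CylCfg w' L → CylCfg w' L) = id := rfl
    rw [hid, Set.preimage_id]
    rfl
  · rw [resLE_succ h, Set.preimage_comp, cylProb_resLast, ih]
    rfl

/-! ## §5 (A) Invariance of `cylArcs` under permutations of the face types -/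

/-- Swapping two adjacent face types preserves `cylArcs` (different kinds: `CylExchange` with
`SlabDeterminacy`; equal kinds: the swap is the identity). -/
theorem cylArcs_τSwap (hX : CylExchange) (hD : SlabDeterminacy) {w L : ℕ} [NeZero L] (hL : 3 ≤ L) (n : ℕ)
    (τ : Fin w → Bool) (i : ℕ) (hi : i + 1 < w) : cylArcs w L (τSwap i hi τ) n = cylArcs w L τ n := by
  by_cases hne : τ ⟨i, by omega⟩ = τ ⟨i + 1, hi⟩
  · have hτ : τSwap i hi τ = τ := by
      funext j
      simp only [τSwap, Function.comp_apply]
      rcases eq_or_ne j ⟨i, by omega⟩ with rfl | h1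
      · rw [Equiv.swap_apply_left]; exact hne.symm
      rcases eq_or_ne j ⟨i + 1, hi⟩ with rfl | h2
      · rw [Equiv.swap_apply_right]; exact hne
      rw [Equiv.swap_apply_of_ne_of_ne h1 h2]
    rw [hτ]
  · exact (hX w L hL τ i hi hne (arcsEvent w L n) (hD w L n i hi)).symm

/-- (A) `cylArcs` is invariant under every permutation of the face types (adjacent transpositions generate the
symmetric group, `Equiv.Perm.mclosure_swap_castSucc_succ`). -/
theorem cylArcs_comp_perm (hX : CylExchange) (hD : SlabDeterminacy) {w L : ℕ} [NeZero L] (hL : 3 ≤ L)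
    (n : ℕ) (σ : Equiv.Perm (Fin w)) (τ : Fin w → Bool) : cylArcs w L (τ ∘ σ) n = cylArcs w L τ n := by
  cases w with
  | zero =>
    congr 1
    funext j
    exact j.elim0
  | succ m =>
    have hσ : σ ∈ Submonoid.closure (Set.range fun i : Fin m => Equiv.swap i.castSucc i.succ) := by
      rw [Equiv.Perm.mclosure_swap_castSucc_succ]; exact Submonoid.mem_top σ
    induction hσ using Submonoid.closure_induction generalizing τ with
    | mem σ hσ =>
      obtain ⟨i, rfl⟩ := hσ
      have key := cylArcs_τSwap hX hD hL n τ i.val (by simp [i.isLt])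
      convert key using 3
      simp only [τSwap]
      congr 2
    | one => rfl
    | mul σ σ' _ _ ih ih' => rw [Equiv.Perm.coe_mul, ← Function.comp_assoc, ih', ih]

/-- (A') Sorting: the face types may be replaced by types that are CONSTANT on the first `w / 2` face columns
(sort them, `Tuple.sort`; if a `true` occurs among the first `w / 2` sorted types, reverse, `Fin.revPerm`). -/
theorem exists_sorted (hX : CylExchange) (hD : SlabDeterminacy) {w L : ℕ} [NeZero L] (hL : 3 ≤ L) (n : ℕ)
    (τ : Fin w → Bool) :
    ∃ (g : Fin w → Bool) (b : Bool), cylArcs w L τ n = cylArcs w L g n ∧ ∀ j : Fin w, j.val < w / 2 → g j = b := by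
  set g : Fin w → Bool := τ ∘ Tuple.sort τ with hg
  have hmono : Monotone g := Tuple.monotone_sort τ
  have h1 : cylArcs w L τ n = cylArcs w L g n := (cylArcs_comp_perm hX hD hL n _ τ).symm
  by_cases hall : ∀ j : Fin w, j.val < w / 2 → g j = false
  · exact ⟨g, false, h1, hall⟩
  · push Not at hall
    obtain ⟨j₀, hj₀, hgj₀⟩ := hall
    refine ⟨g ∘ Fin.revPerm, true, ?_, fun j hj => ?_⟩
    · rw [cylArcs_comp_perm hX hD hL n Fin.revPerm g]
      exact h1
    · have hle : j₀ ≤ Fin.rev j := by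
        rw [Fin.le_iff_val_le_val, Fin.val_rev]
        omega
      have hmj := hmono hle
      rw [Bool.le_iff_imp] at hmj
      simp only [Function.comp_apply, Fin.revPerm_apply]
      exact hmj (by simpa using hgj₀)

end CylBunchStub

open CylBunchStub in
/-- **STUB · `stub_cylBunch`**: `CylExchange → SlabDeterminacy → CylBunching`.  Permute the face types so that
they are constant (`= b`) on the first `w / 2` face columns (A); the arcs event of the slab contains the pulled
back arcs event of the left sub-slab of `w / 2` face columns (C), whose probability under the slab law is its
probability under the sub-slab law (B), i.e. the PURE arcs probability `cylArcs (w / 2) L (fun _ => b) n`. -/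
theorem stub_cylBunch : CylExchange → SlabDeterminacy → CylBunching := by
  intro hX hD w L n _ hL τ
  obtain ⟨g, b, hτg, hg⟩ := exists_sorted hX hD hL n τ
  have h : w / 2 ≤ w := Nat.div_le_self w 2
  have hconst : (fun j : Fin (w / 2) => g (Fin.castLE h j)) = fun _ => b :=
    funext fun j => hg _ (by simp [j.isLt])
  have hmarg := cylProb_resLE L (arcsEvent (w / 2) L n) w h g
  rw [hconst] at hmarg
  have hmono := cylProb_mono w L g (resLE_preimage_arcsEvent_subset L n h)
  rw [hmarg] at hmono
  rw [hτg]
  unfold cylArcs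
  cases b
  · exact (min_le_left _ _).trans hmono
  · exact (min_le_right _ _).trans hmono

end Summit.CriticalPhenomena.CardyFormulaZ2.Cruxes.IKMixedBoxCrossing.DefectClosureExploration

end
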